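import Summits.CriticalPhenomena.CardyFormulaZ2.Theorems.CardyIKTransportIKLinearTransportSDECore2

/-!
# Stub `stub_StripDiagramExchange` — core part 3: graph toolkit

Continues `…SDECore2`. Restriction of a graph to a vertex set (`SDE.within`) and its relation to induced subgraphs,
the first-exit decomposition of a path and the intermediate-row lemma; the square grid with one diagonal per face
(`SDE.grid`) and the two graphs of the vocabulary in grid form: `cellGraph` exactly, `blockGraph` at interior rows of the
cylinder read off the strip window.
-/

set_option autoImplicit false

noncomputable section

namespace Summit.CriticalPhenomena.CardyFormulaZ2.Theorems.IKLinearTransport.PinnedDiagramExchange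

open scoped Classical MeasureTheory ENNReal ProbabilityTheory BigOperators
open MeasureTheory Literature.Probability.Percolation Literature.Probability.LatticeModels

namespace SDE

/-! ## §8 Graph toolkit: restriction to a vertex set, first exit, intermediate rows -/

section Graph

variable {V : Type*}

/-- Restriction of a graph to a vertex set, as a graph on the full vertex type. [folklore] -/
def within (G : SimpleGraph V) (s : Set V) : SimpleGraph V where
  Adj u v := G.Adj u v ∧ u ∈ s ∧ v ∈ s
  symm := ⟨fun _ _ h => ⟨h.1.symm, h.2.2, h.2.1⟩⟩
  loopless := ⟨fun _ h => h.1.ne rfl⟩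

/-- Adjacency of `within`. [folklore] -/
theorem within_adj (G : SimpleGraph V) (s : Set V) (u v : V) :
    (within G s).Adj u v ↔ G.Adj u v ∧ u ∈ s ∧ v ∈ s := Iff.rfl

/-- `within` is monotone in the vertex set. [folklore] -/
theorem within_mono (G : SimpleGraph V) {s t : Set V} (hst : s ⊆ t) {u v : V}
    (h : (within G s).Reachable u v) : (within G t).Reachable u v :=
  let φ : within G s →g within G t := { toFun := id, map_rel' := fun hab => ⟨hab.1, hst hab.2.1, hst hab.2.2⟩ }
  h.map φ

/-- `within` is monotone in the graph on the vertex set. [folklore] -/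
theorem within_mono_graph {G H : SimpleGraph V} (s : Set V) (hGH : ∀ u v, u ∈ s → v ∈ s → G.Adj u v → H.Adj u v)
    {u v : V} (h : (within G s).Reachable u v) : (within H s).Reachable u v :=
  let φ : within G s →g within H s :=
    { toFun := id, map_rel' := fun hab => ⟨hGH _ _ hab.2.1 hab.2.2 hab.1, hab.2.1, hab.2.2⟩ }
  h.map φ

/-- Reachability inside `s` from a vertex of `s` ends in `s`. [folklore] -/
theorem within_reachable_mem (G : SimpleGraph V) (s : Set V) {u v : V} (h : (within G s).Reachable u v)
    (hu : u ∈ s) : v ∈ s := by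
  rw [SimpleGraph.reachable_iff_reflTransGen] at h
  induction h with
  | refl => exact hu
  | tail _ hbc _ => exact hbc.2.2

/-- Reachability in the induced subgraph is reachability in `within`. [folklore] -/
theorem induce_reachable_iff (G : SimpleGraph V) (s : Set V) {u v : V} (hu : u ∈ s) (hv : v ∈ s) :
    (G.induce s).Reachable ⟨u, hu⟩ ⟨v, hv⟩ ↔ (within G s).Reachable u v := by
  constructor
  · intro h
    let φ : G.induce s →g within G s :=
      { toFun := fun x => x.1
        map_rel' := fun {x y} hxy => ⟨hxy, x.2, y.2⟩ }
    exact h.map φ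
  · intro h
    rw [SimpleGraph.reachable_iff_reflTransGen] at h
    revert hv
    induction h with
    | refl => intro hv; exact SimpleGraph.Reachable.refl _
    | tail _ hbc ih =>
      intro hv
      exact (ih hbc.2.1).trans (SimpleGraph.Adj.reachable (show (G.induce s).Adj ⟨_, hbc.2.1⟩ ⟨_, hv⟩ from hbc.1))

/-- FIRST EXIT: a path from `u ∈ W` either stays inside `W` or reaches, inside `W`, a vertex of `W` adjacent to a
vertex outside `W`. [folklore] -/
theorem exists_exit (G : SimpleGraph V) (W : Set V) {u v : V} (hu : u ∈ W) (h : G.Reachable u v) :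
    (within G W).Reachable u v ∨ ∃ w w', w ∈ W ∧ w' ∉ W ∧ G.Adj w w' ∧ (within G W).Reachable u w := by
  rw [SimpleGraph.reachable_iff_reflTransGen] at h
  induction h with
  | refl => exact Or.inl (SimpleGraph.Reachable.refl _)
  | @tail b c _ hbc ih =>
    rcases ih with hr | hr
    · by_cases hc : c ∈ W
      · exact Or.inl (hr.trans (SimpleGraph.Adj.reachable ⟨hbc, within_reachable_mem G W hr hu, hc⟩))
      · exact Or.inr ⟨b, c, within_reachable_mem G W hr hu, hc, hbc, hr⟩
    · exact Or.inr hr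

/-- INTERMEDIATE ROWS: if adjacent vertices have rows differing by at most one, a path from row `≤ y` to row `≥ y`
visits row `y`. [folklore] -/
theorem exists_row_eq (G : SimpleGraph V) (row : V → ℤ) (hG : ∀ u v, G.Adj u v → row v ≤ row u + 1)
    {u v : V} (h : G.Reachable u v) (y : ℤ) (h1 : row u ≤ y) (h2 : y ≤ row v) :
    ∃ w, G.Reachable u w ∧ row w = y := by
  rw [SimpleGraph.reachable_iff_reflTransGen] at h
  revert h2
  induction h with
  | refl => intro h2; exact ⟨u, SimpleGraph.Reachable.refl _, by omega⟩
  | @tail b c hab hbc ih =>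
    intro h2
    by_cases hy : y ≤ row b
    · exact ih hy
    · have := hG b c hbc
      exact ⟨c, (SimpleGraph.reachable_iff_reflTransGen _ _).2 (hab.tail hbc), by omega⟩

end Graph

/-! ## §9 The square grid with diagonals, and the two graphs of the vocabulary in grid form -/

/-- The square grid with one diagonal per face: nearest neighbours, the main diagonal of the face with lower-left corner
`p` unless `fl p`, the anti-diagonal `(c, d+1) — (c+1, d)` of the face `(c, d)` when `fl c d`. [folklore] -/
def grid (fl : ℤ → ℤ → Prop) : SimpleGraph (ℤ × ℤ) :=
  SimpleGraph.fromRel fun p q => q = (p.1 + 1, p.2) ∨ q = (p.1, p.2 + 1) ∨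
    (q = (p.1 + 1, p.2 + 1) ∧ ¬ fl p.1 p.2) ∨ (q = (p.1 + 1, p.2 - 1) ∧ fl p.1 (p.2 - 1))

/-- Adjacency of the grid in coordinates. [folklore] -/
theorem grid_adj (fl : ℤ → ℤ → Prop) (p q : ℤ × ℤ) : (grid fl).Adj p q ↔
    ((q.1 = p.1 + 1 ∧ q.2 = p.2) ∨ (q.1 = p.1 ∧ q.2 = p.2 + 1) ∨
      (q.1 = p.1 + 1 ∧ q.2 = p.2 + 1 ∧ ¬ fl p.1 p.2) ∨ (q.1 = p.1 + 1 ∧ q.2 = p.2 - 1 ∧ fl p.1 (p.2 - 1))) ∨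
    ((p.1 = q.1 + 1 ∧ p.2 = q.2) ∨ (p.1 = q.1 ∧ p.2 = q.2 + 1) ∨
      (p.1 = q.1 + 1 ∧ p.2 = q.2 + 1 ∧ ¬ fl q.1 q.2) ∨ (p.1 = q.1 + 1 ∧ p.2 = q.2 - 1 ∧ fl q.1 (q.2 - 1))) := by
  obtain ⟨p1, p2⟩ := p
  obtain ⟨q1, q2⟩ := q
  simp only [grid, SimpleGraph.fromRel_adj, ne_eq, Prod.mk.injEq, and_assoc]
  constructor
  · rintro ⟨-, h⟩; exact h
  · intro h; exact ⟨by omega, h⟩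

/-- Grid edges join points at sup-distance one. [folklore] -/
theorem grid_adj_near (fl : ℤ → ℤ → Prop) {p q : ℤ × ℤ} (h : (grid fl).Adj p q) :
    q.2 ≤ p.2 + 1 ∧ p.2 ≤ q.2 + 1 ∧ q.1 ≤ p.1 + 1 ∧ p.1 ≤ q.1 + 1 ∧ p ≠ q := by
  refine ⟨?_, ?_, ?_, ?_, h.ne⟩ <;> rw [grid_adj] at h <;> omega

/-- Translating the grid (with the flags) preserves adjacency; only the flags of the faces spanned by the edge matter. [folklore] -/
theorem grid_adj_map (fl fl' : ℤ → ℤ → Prop) (s t : ℤ) (p q : ℤ × ℤ)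
    (h : ∀ c d, ((c = p.1 ∧ c + 1 = q.1) ∨ (c = q.1 ∧ c + 1 = p.1)) →
      ((d = p.2 ∧ d + 1 = q.2) ∨ (d = q.2 ∧ d + 1 = p.2)) → (fl c d ↔ fl' (c + s) (d + t))) :
    (grid fl).Adj p q ↔ (grid fl').Adj (p.1 + s, p.2 + t) (q.1 + s, q.2 + t) := by
  rw [grid_adj, grid_adj]
  simp only
  have hp : ∀ d, p.1 + 1 = q.1 → ((d = p.2 ∧ d + 1 = q.2) ∨ (d = q.2 ∧ d + 1 = p.2)) →
      (fl p.1 d ↔ fl' (p.1 + s) (d + t)) := fun d e hd => h p.1 d (Or.inl ⟨rfl, e⟩) hd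
  have hq : ∀ d, q.1 + 1 = p.1 → ((d = p.2 ∧ d + 1 = q.2) ∨ (d = q.2 ∧ d + 1 = p.2)) →
      (fl q.1 d ↔ fl' (q.1 + s) (d + t)) := fun d e hd => h q.1 d (Or.inr ⟨rfl, e⟩) hd
  constructor
  · rintro (h1 | h1)
    · left
      rcases h1 with h1 | h1 | ⟨e1, e2, h1⟩ | ⟨e1, e2, h1⟩
      · left; omega
      · right; left; omega
      · right; right; left; refine ⟨by omega, by omega, ?_⟩; rwa [← hp _ e1.symm (Or.inl ⟨rfl, by omega⟩)]
      · right; right; right; refine ⟨by omega, by omega, ?_⟩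
        rw [show p.2 + t - 1 = (p.2 - 1) + t by ring, ← hp _ e1.symm (Or.inr ⟨by omega, by omega⟩)]; exact h1
    · right
      rcases h1 with h1 | h1 | ⟨e1, e2, h1⟩ | ⟨e1, e2, h1⟩
      · left; omega
      · right; left; omega
      · right; right; left; refine ⟨by omega, by omega, ?_⟩; rwa [← hq _ e1.symm (Or.inr ⟨rfl, by omega⟩)]
      · right; right; right; refine ⟨by omega, by omega, ?_⟩
        rw [show q.2 + t - 1 = (q.2 - 1) + t by ring, ← hq _ e1.symm (Or.inl ⟨by omega, by omega⟩)]; exact h1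
  · rintro (h1 | h1)
    · left
      rcases h1 with h1 | h1 | ⟨e1, e2, h1⟩ | ⟨e1, e2, h1⟩
      · left; omega
      · right; left; omega
      · right; right; left; refine ⟨by omega, by omega, ?_⟩; rwa [hp _ (by omega) (Or.inl ⟨rfl, by omega⟩)]
      · right; right; right; refine ⟨by omega, by omega, ?_⟩
        rw [hp _ (by omega) (Or.inr ⟨by omega, by omega⟩), show (p.2 - 1) + t = p.2 + t - 1 by ring]; exact h1
    · right
      rcases h1 with h1 | h1 | ⟨e1, e2, h1⟩ | ⟨e1, e2, h1⟩
      · left; omega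
      · right; left; omega
      · right; right; left; refine ⟨by omega, by omega, ?_⟩; rwa [hq _ (by omega) (Or.inr ⟨rfl, by omega⟩)]
      · right; right; right; refine ⟨by omega, by omega, ?_⟩
        rw [hq _ (by omega) (Or.inl ⟨by omega, by omega⟩), show (q.2 - 1) + t = q.2 + t - 1 by ring]; exact h1

/-- Coordinates of cells. [folklore] -/
theorem site2_eq_iff (u v : Site 2) : u = v ↔ u 0 = v 0 ∧ u 1 = v 1 := by
  constructor
  · rintro rfl; exact ⟨rfl, rfl⟩
  · rintro ⟨h0, h1⟩; funext j; fin_cases j <;> assumption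

/-- Coordinates of translated cells. [folklore] -/
theorem site2_eq_add_iff (u v : Site 2) (c d : ℤ) : v = u + ![c, d] ↔ v 0 = u 0 + c ∧ v 1 = u 1 + d := by
  rw [site2_eq_iff]; simp

/-- A cell from its coordinates. [folklore] -/
theorem site2_eta (u : Site 2) : (![u 0, u 1] : Site 2) = u := by
  funext j; fin_cases j <;> rfl

/-- THE RANDOM TRIANGULATION IN GRID FORM: `cellGraph A` is the grid whose flags are the anti-diagonal faces `A`. [folklore] -/
theorem cellGraph_adj_iff (A : Set (Site 2)) (u v : Site 2) :
    (cellGraph A).Adj u v ↔ (grid (fun c d => (![c, d] : Site 2) ∈ A)).Adj (u 0, u 1) (v 0, v 1) := by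
  have hu : u + ![0, -1] = ![u 0, u 1 - 1] := funext fun j => by fin_cases j <;> simp [sub_eq_add_neg]
  have hv : v + ![0, -1] = ![v 0, v 1 - 1] := funext fun j => by fin_cases j <;> simp [sub_eq_add_neg]
  have hAu : u ∉ A ↔ ¬ (![u 0, u 1] : Site 2) ∈ A := by rw [site2_eta]
  have hAv : v ∉ A ↔ ¬ (![v 0, v 1] : Site 2) ∈ A := by rw [site2_eta]
  rw [grid_adj]
  simp only [cellGraph, SimpleGraph.fromRel_adj, site2_eq_add_iff, hu, hv, hAu, hAv, Ne, site2_eq_iff u v,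
    and_assoc, ← sub_eq_add_neg, add_zero]
  constructor
  · rintro ⟨-, h⟩; exact h
  · intro h; exact ⟨by omega, h⟩

/-- Successor rows of the cylinder, no wrap from above. [folklore] -/
theorem rowOf_add_one (a : ℤ) {N : ℕ} [NeZero N] (r : ZMod N) (h : rowOf a r + 1 < a + N) :
    rowOf a (r + 1) = rowOf a r + 1 := by
  simp only [rowOf] at h ⊢
  rw [ZMod.val_add, ZMod.val_one_eq_one_mod, Nat.add_mod_mod, Nat.mod_eq_of_lt (by omega)]
  push_cast; ring

/-- `rowOf` is injective. [folklore] -/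
theorem rowOf_inj (a : ℤ) {N : ℕ} [NeZero N] {r r' : ZMod N} : rowOf a r = rowOf a r' ↔ r = r' := by
  constructor
  · intro h; simp only [rowOf] at h; exact ZMod.val_injective N (by exact_mod_cast (by omega : (r.val : ℤ) = r'.val))
  · rintro rfl; rfl

/-- Successor test through `rowOf` (predecessor interior from above). [folklore] -/
theorem succ_iff_rowOf (a : ℤ) {N : ℕ} [NeZero N] (r r' : ZMod N) (h : rowOf a r + 1 < a + N) :
    r' = r + 1 ↔ rowOf a r' = rowOf a r + 1 := by
  rw [← rowOf_add_one a r h, rowOf_inj]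

/-- Successor test through `rowOf` (successor interior from below). [folklore] -/
theorem succ_iff_rowOf' (a : ℤ) {N : ℕ} [NeZero N] (r r' : ZMod N) (h : a + 1 ≤ rowOf a r') :
    r' = r + 1 ↔ rowOf a r' = rowOf a r + 1 := by
  by_cases h' : rowOf a r + 1 < a + N
  · exact succ_iff_rowOf a r r' h'
  · have hr : rowOf a r = a + N - 1 := by have := (rowOf_mem a r).2; omega
    constructor
    · rintro rfl
      exfalso
      have hv : (r + 1).val = 0 := by
        rw [ZMod.val_add, ZMod.val_one_eq_one_mod, Nat.add_mod_mod]
        simp only [rowOf] at hr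
        rw [show r.val + 1 = N by omega, Nat.mod_self]
      simp only [rowOf, hv] at h; omega
    · intro e; have := (rowOf_mem a r').2; omega

/-- THE CYLINDER BLOCK IN GRID FORM, at an interior row: `blockGraph` read through `(column, rowOf)`. [folklore] -/
theorem blockGraph_adj_iff {N : ℕ} [NeZero N] (a : ℤ) (α : Fin 2 × ZMod N → Bool) (x y : Fin 3 × ZMod N)
    (hx : a + 1 ≤ rowOf a x.2) (hx' : rowOf a x.2 + 1 < a + N) :
    (blockGraph N α).Adj x y ↔
      (grid (fun c d => ∃ j : Fin 2, ((j : ℕ) : ℤ) = c ∧ α (j, zOf a N d) = true)).Adj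
        (((x.1 : ℕ) : ℤ), rowOf a x.2) (((y.1 : ℕ) : ℤ), rowOf a y.2) := by
  simp only [blockGraph, SimpleGraph.fromRel_adj, ne_eq]
  have hcol : ∀ j j' : Fin 3, ((j : ℕ) : ℤ) = (j' : ℕ) ↔ j = j' := fun j j' =>
    ⟨fun h => Fin.ext (by exact_mod_cast h), fun h => by rw [h]⟩
  have hfin : ∀ (x1 y1 : Fin 3), (∃ j : Fin 2, x1 = j.castSucc ∧ y1 = j.succ) ↔ ((y1 : ℕ) : ℤ) = (x1 : ℕ) + 1 := by
    intro x1 y1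
    constructor
    · rintro ⟨j, rfl, rfl⟩; simp [Fin.val_succ]
    · intro h
      have hx1 : (x1 : ℕ) < 2 := by have := y1.2; omega
      refine ⟨⟨x1, hx1⟩, Fin.ext rfl, Fin.ext ?_⟩
      simp only [Fin.val_succ]; omega
  have hfl : ∀ (x1 : Fin 3) (j : Fin 2) (r : ZMod N), x1 = j.castSucc →
      ((∃ j' : Fin 2, ((j' : ℕ) : ℤ) = (x1 : ℕ) ∧ α (j', zOf a N (rowOf a r)) = true) ↔ α (j, r) = true) := by
    rintro x1 j r rfl
    rw [zOf_rowOf]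
    constructor
    · rintro ⟨j', hj', h⟩
      have : j' = j := Fin.ext (by simpa using hj')
      rwa [this] at h
    · intro h; exact ⟨j, by simp, h⟩
  have hxy : x = y ↔ (((x.1 : ℕ) : ℤ) = (y.1 : ℕ) ∧ rowOf a x.2 = rowOf a y.2) := by
    rw [hcol, rowOf_inj, Prod.ext_iff]
  simp only [grid, SimpleGraph.fromRel_adj, ne_eq, Prod.mk.injEq, and_assoc]
  apply and_congr (not_congr hxy)
  apply or_congr
  · -- relation from x to y
    refine or_left_comm.trans ?_
    apply or_congr
    · constructor
      · rintro ⟨h1, h2⟩; exact ⟨by exact_mod_cast h1, by rw [h2]⟩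
      · rintro ⟨h1, h2⟩; exact ⟨by exact_mod_cast h1, (rowOf_inj a).1 h2⟩
    apply or_congr
    · rw [succ_iff_rowOf a x.2 y.2 hx', ← hcol y.1 x.1]
    apply or_congr
    · constructor
      · rintro ⟨j, h1, h2, h3, h4⟩
        refine ⟨((hfin x.1 y.1).1 ⟨j, h1, h2⟩), (succ_iff_rowOf a x.2 y.2 hx').1 h3, ?_⟩
        rw [hfl x.1 j x.2 h1, h4]; decide
      · rintro ⟨h1, h2, h3⟩
        obtain ⟨j, hj1, hj2⟩ := (hfin x.1 y.1).2 h1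
        refine ⟨j, hj1, hj2, (succ_iff_rowOf a x.2 y.2 hx').2 h2, ?_⟩
        rw [hfl x.1 j x.2 hj1] at h3; simpa using h3
    · constructor
      · rintro ⟨j, h1, h2, h3, h4⟩
        have e : rowOf a y.2 = rowOf a x.2 - 1 := by
          have := (succ_iff_rowOf' a y.2 x.2 hx).1 h3; omega
        refine ⟨(hfin x.1 y.1).1 ⟨j, h1, h2⟩, e, ?_⟩
        rw [← e, hfl x.1 j y.2 h1, h4]
      · rintro ⟨h1, h2, h3⟩
        obtain ⟨j, hj1, hj2⟩ := (hfin x.1 y.1).2 h1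
        refine ⟨j, hj1, hj2, (succ_iff_rowOf' a y.2 x.2 hx).2 (by omega), ?_⟩
        rw [show rowOf a x.2 - 1 = rowOf a y.2 by omega, hfl x.1 j y.2 hj1] at h3; exact h3
  · -- relation from y to x
    refine or_left_comm.trans ?_
    apply or_congr
    · constructor
      · rintro ⟨h1, h2⟩; exact ⟨by exact_mod_cast h1, by rw [h2]⟩
      · rintro ⟨h1, h2⟩; exact ⟨by exact_mod_cast h1, (rowOf_inj a).1 h2⟩
    apply or_congr
    · rw [succ_iff_rowOf' a y.2 x.2 hx, ← hcol x.1 y.1]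
    apply or_congr
    · constructor
      · rintro ⟨j, h1, h2, h3, h4⟩
        have e := (succ_iff_rowOf' a y.2 x.2 hx).1 h3
        refine ⟨(hfin y.1 x.1).1 ⟨j, h1, h2⟩, e, ?_⟩
        rw [hfl y.1 j y.2 h1, h4]; decide
      · rintro ⟨h1, h2, h3⟩
        obtain ⟨j, hj1, hj2⟩ := (hfin y.1 x.1).2 h1
        refine ⟨j, hj1, hj2, (succ_iff_rowOf' a y.2 x.2 hx).2 h2, ?_⟩
        rw [hfl y.1 j y.2 hj1] at h3; simpa using h3
    · constructor
      · rintro ⟨j, h1, h2, h3, h4⟩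
        have e : rowOf a x.2 = rowOf a y.2 - 1 := by
          have := (succ_iff_rowOf a x.2 y.2 hx').1 h3; omega
        refine ⟨(hfin y.1 x.1).1 ⟨j, h1, h2⟩, e, ?_⟩
        rw [← e, hfl y.1 j x.2 h1, h4]
      · rintro ⟨h1, h2, h3⟩
        obtain ⟨j, hj1, hj2⟩ := (hfin y.1 x.1).2 h1
        refine ⟨j, hj1, hj2, (succ_iff_rowOf a x.2 y.2 hx').2 (by omega), ?_⟩
        rw [show rowOf a y.2 - 1 = rowOf a x.2 by omega, hfl y.1 j x.2 hj1] at h3; exact h3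



end SDE

/-- THE CYLINDER BLOCK IN GRID FORM (part 3 of `stub_StripDiagramExchange`): at an interior row of the window
`[a, a+N)`, adjacency in `blockGraph` is adjacency in the square grid with the flags read through `(column, rowOf)`. [folklore] -/
theorem stripDX_blockGrid : ∀ (N : ℕ) [NeZero N] (a : ℤ) (α : Fin 2 × ZMod N → Bool) (x y : Fin 3 × ZMod N), a + 1 ≤ SDE.rowOf a x.2 → SDE.rowOf a x.2 + 1 < a + N → ((blockGraph N α).Adj x y ↔ (SDE.grid (fun c d => ∃ j : Fin 2, ((j : ℕ) : ℤ) = c ∧ α (j, SDE.zOf a N d) = true)).Adj (((x.1 : ℕ) : ℤ), SDE.rowOf a x.2) (((y.1 : ℕ) : ℤ), SDE.rowOf a y.2)) :=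
  fun _ _ a α x y hx hx' => SDE.blockGraph_adj_iff a α x y hx hx'

end Summit.CriticalPhenomena.CardyFormulaZ2.Theorems.IKLinearTransport.PinnedDiagramExchange
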